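import Literature.Claims.NS.Dou2026b
import Literature.Analysis.FluidPDE.PolynomialFieldCertificates
import HarnessLib

/-!
# Claim skeleton: Dou (2026c), «Disproving the Existence of Global Smooth Solutions to the
# Three-Dimensional Navier–Stokes Equations for Plane Poiseuille Flow» (Preprints.org 202509.1747 v3)

Cell `ns-claims` (D-0090 NS-CLAIMS SWEEP), claim C54 (census cluster `Dou2022`), typist
`ns-claims-typist-3` (g2); RULINGS v1.29l (1): own row, importing the sibling skeleton
`Literature.Claims.NS.Dou2026b` (C54b, the FORCED/periodic version of the same device).
UNREFEREED/DISPUTED CLAIM under adjudication — NOTHING in this file asserts a step: every `Step…`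
declaration is a `Prop`; the `theorem`s are unfolding lemmas and the kernel composition
`claim_of_steps`. Refutations go summit-side (`Theorems/SoloRefuteDou2026c.lean`).

Version of record (lit-3 g2 VERSION DELTA 2026-08-27T01:23:08Z, `pub/ns-claims/sources/Dou2026/
LOCATORS.md` §0): Hua-Shu Dou, Preprints.org 202509.1747 **v3** (13 May 2026; CC BY; NOT
peer-reviewed; 22 PDF pp., printed page = PDF page − 1), doi:10.20944/preprints202509.1747.v3
[Dou2026c]. LOCATORS ARE PDF PAGES/LINES of `Preprints2026-202509.1747v3_PINNED/pages/p00NN.txt`.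
Claimed statement (Thm 4.1) identical to v2 [Dou2026]; decisive step CHANGED: v2's interior
elliptic estimate (19) is gone, v3 argues through the «Energy–Velocity Monotonicity Principle»
(EVMP) Theorem 3.1 (16)/(A3) and its Appendix §8.

## Claimed statement (as printed, Theorem 4.1, PDF p.10 l.37–51)

«Theorem 4.1: For 3D plane Poiseuille flow with initial data u₀ ∈ H³_{σ,0}(Ω), at the condition of
small initial disturbance ‖v₀‖_{H³(Ω)} ≪ ‖U₀‖_{H³(Ω)}, when Re > Re_cr, there exists a finite time
t* > 0 and a point x* ∈ Ω \ ∂Ω such that (x*, t*) is a Navier-Stokes singularity. At the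
singularity, the solution degenerates to a subcritical regularity space. As t → t*,
‖∇u(t)‖_{L∞(Ω)} → ∞, hence the 3D Navier-Stokes equations has no global smooth solutions.»
Abstract PDF p.2: «Existence of global smooth solutions to the three-dimensional (3D) Navier-Stokes
equations is disproved for pressure-driven plane Poiseuille flow with no-slip boundary conditions.»
Setting §2.1 PDF p.4–5: channel between plates `y = ±h`, no-slip, unforced NS (3) (density ρ,
µ = ρν), `H³_{σ,0}(Ω) = {f ∈ H³ : ∇·f = 0, f|_∂Ω = 0}`, data «a steady plane Poiseuille flow
superposed with small-amplitude disturbances: u₀ = U₀(y) + v₀, U₀(y) = −(1/2µ)(dp/dx)(h² − y²) i,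
∇·v₀ = 0, ‖v₀‖_{H³} ≪ ‖U₀‖_{H³}», «the instantaneous velocity is always kept positive … u > 0 in
Ω × [0,T)»; Re = U_{x0c} h/ν (4) with U_{x0c} the centreline velocity; «Re > Re_cr» PDF p.6 (Re_cr
= 1130 quoted for plane Poiseuille flow, the paper's own value «can be» different — carried as a
parameter). «Singularity» = Definition 3.1 PDF p.9: «(1) lim_{t→t*} ‖Δu(·,t)‖_{H¹(B_ε(x*))} = 0,
(2) limsup_{t→t*} ‖u(·,t)‖_{H³(B_ε(x*))} > 0».

TYPED (`ClaimedTheorem Recr`; `ClaimedTheoremE` = ∃ Recr): after division by ρ (pressure `p/ρ`,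
µ/ρ = ν; pressure gradient `G = −(1/ρ)dp/dx > 0`), for all `ν, h, G > 0` and every ADMISSIBLE
disturbance `v₀` (smooth, divergence free in the slab, zero on the walls, pointwise smaller than the
base flow in the open slab — the grain at which «small» is used, (22)), `Re = (G h²/2ν)·h/ν > Recr`
⇒ there is NO `(u, p)`: jointly smooth on `ℝ³ × [0,∞)`, solving the unforced equations classically
IN THE SLAB `|y| < h`, divergence free there, `u = 0` on the walls, pressure = `−Gx` + bounded
remainder and bounded velocity on the slab (Appendix §8.1; rev 2), `u(·,0) = U₀ + v₀` in the slab.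
RENDERING (Δ5, declared): the printed class `C([0,∞); H³_{σ,0}(Ω))` is rendered by smooth fields on
`ℝ³ × [0,∞)` (every field smooth up to the walls extends smoothly; the equations are asked only in
the open slab) — the typed non-existence is WEAKER than (implied by) the printed one. NB (vacuity /
F2 audit, for the referee): the printed hypotheses ADMIT `v₀ = 0` («small»), for which the steady
Poiseuille flow `u = U₀`, `p = −Gx` is a global smooth solution of the typed problem (`Step0_baseFlow`,
the paper's own §2.1 sentence) — so `ClaimedTheorem Recr` as printed/typed is refutable by the base
flow itself; reading «superposed with small-amplitude disturbances» as `v₀ ≠ 0` is a referee call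
(then the statement is a genuine instability claim, not kernel-decidable).

## Clay delta (reference `ClayVariants.lean`)

Nearest Clay statement: none — a wall-bounded channel with no-slip walls and a driving pressure
gradient is neither (C) (ℝ³, decaying data) nor (D) (𝕋³): Δ1 DOMAIN (the paper's own scope, §7 item
7 PDF p.17: «strictly applicable to pressure-driven plane Poiseuille flows with no-slip boundary
conditions»); Δ3 pressure-driven (constant pressure gradient), no force; Δ4 Poiseuille + small `H³`
disturbance, `Re > Re_cr` free threshold; Δ5/Δ6 own singularity notion Def 3.1 / Def 3.2; Δ7 fixed
ν. `clay_of_claimed`: NOT APPLICABLE -- DELTA Δ1: no Clay statement is implied.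

## Steps, in the dependency order of the printed proof (paper item · PDF page · flag)

* Step 0 = `Step0_baseFlow` — §2.1 PDF p.5 l.8–11 («the initial laminar velocity field is a steady
  plane Poiseuille flow … U₀(y) = −(1/2µ)(dp/dx)(h² − y²) i»): the Poiseuille profile with the linear
  pressure `−Gx` is a steady solution of the typed channel problem — true (polynomial calculus;
  proof offered summit-side in the typist's kit, not needed by the composition).
* Step 1 = `Step1_vanishingPoint` — Step 1 items (2)–(3) PDF p.12 l.14–56 with (20) («For Re >
  Re_cr, the disturbance velocity v(t) is amplified by the nonlinear term … there exists t* and x*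
  such that Δv(x*,t*) = −ΔU(x*,t*) … hence Δu(x*,t*) = 0. By H¹-continuity, lim ‖Δu(·,t)‖_{H¹(B_ε
  (x*))} = 0 (20)») together with §3.2 item 2(b) PDF p.9 («∂u/∂t = 0 … occurs at the maximum or the
  minimum of the disturbance velocity», the clause under which (16) is applied at (x*, t*)):
  asserted — unfilled gap; for `v₀ = 0` false by Step 0 (`ΔU₀ = −(G/ν) e_x ≠ 0` everywhere).
* Step 2 = `Step2_thm31` — THEOREM 3.1 (16) PDF p.9 l.10–16 = Appendix (A3) PDF p.19 l.2–7, proved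
  by Appendix Lemma 2 PDF p.19 l.53–68 («… there is no potential barrier to drive the velocity
  field. Combined with the no-slip boundary condition and the property of laminar flow without
  self-excited motion, and ∂u/∂t = 0 …, the velocity field cannot form a non-zero flow at this
  point, so |u(x,t)| = 0»), AT THE PRINTED CLASS (unforced, no-slip channel solutions): at a point
  with `∂_t u = 0` and `Δu = 0`, `u = 0`. Typist's flag: unfilled gap (Lemma 2's sentence is the
  EVMP «axiom» restated); the GENERAL form is the sibling's `Dou2026b.Step6_EVMP` with `f = 0`
  (kernel-false by plane Couette — which §7 item 7 scopes OUT; inside the printed class no cheap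
  witness: for unidirectional pressure-driven profiles `∂_t U = νU_yy + G` forces `U_yy ≠ 0`
  wherever `∂_t U = 0`).
* Step 3 = `Step3_16to21` — Step 2 (1) PDF p.12 l.72–78 («By Eq.(16), which is the analytical
  result from EVMP, lim ‖Δu(·,t)‖_{H¹(B_ε(x*))} = 0 implies lim ‖u(·,t)‖_{H³(B_ε(x*))} = 0 (21)»):
  the printed inference from the POINTWISE principle (16) to LOCAL vanishing on a ball, typed as
  `Step2_thm31 → LocalVanishingChannel`. Typist's flag: unfilled gap / LOGIC — no sentence connects
  a pointwise statement under `Δu(x*,t*) = 0` to the vanishing of `u(·,t*)` on `B_ε(x*)`; the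
  consequent `LocalVanishingChannel` in general form is the sibling's `Dou2026b.LocalVanishing`
  (kernel-false by Couette, outside the printed class). THE DECISIVE STEP per the typist's PREDICTION.
* Step 4 = `Step4_positivity` — Step 2 (2) (22) PDF p.12 l.79–88 («for t < t*, U ∈ H³(Ω) implies
  U(x*,t) > 0 (pressure-driven flow), and ‖v(t)‖ ≪ ‖U(t)‖ (laminar flow constraint) … ‖u(t)‖_{L∞
  (B_ε(x*))} ≥ ‖U(t)‖ − ‖v(t)‖ > 0 (22)») with §2.1 «u > 0 in Ω × [0,T)»: every solution stays
  non-zero at interior points — asserted (gap).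
* Steps 3–5 of the paper (velocity discontinuity (23), gradient divergence, BKM §5) PDF p.12–15 are
  downstream restatements of the contradiction (21)/(22) — not typed (same pattern as C54b Step 9).
Ordered index (TYPING-HYGIENE 11): 0 → 1 → 2 → 3 → 4 → Thm 4.1; `claim_of_steps` consumes 1, 2, 3,
4 (Step 0 is the setting's exact solution, recorded for the vacuity audit).

## KERNEL COMPOSITION: Step 1 → Step 2 → Step 3 → Step 4 → ClaimedTheorem — PROVED (`claim_of_steps`:
a global solution would vanish on `B_ε(x*)` at `t*` by (16) ⇒ (21) and be non-zero at `x*` by (22)).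

WHAT THIS IS NOT: not a claim about NS regularity or blow-up; not a claim about any author beyond the
typed locator.
-/

noncomputable section

open Set Function Filter MeasureTheory
open scoped Topology ENNReal NNReal ContDiff Laplacian

namespace Literature.Claims.NS.Dou2026c

open Literature.Analysis.FluidPDE Literature.Claims.NS.Dou2026b

/-! ## The printed objects (PDF p.4–6), after division of (3) by ρ -/

/-- The open channel (slab) `Ω = {−h < y < h}` between the plates (walls at `y = ±h`; unbounded /
periodic in `x, z` as in plane Poiseuille flow). [cite: Dou2026c, §2.1 (PDF p.4–5), Fig. 1] -/
def slab (h : ℝ) : Set (EuclideanSpace ℝ (Fin 3)) := {x | -h < x 1 ∧ x 1 < h}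

/-- The walls `y = ±h`. [cite: Dou2026c, §2.1 (PDF p.5), no-slip condition] -/
def walls (h : ℝ) : Set (EuclideanSpace ℝ (Fin 3)) := {x | x 1 = h ∨ x 1 = -h}

/-- The Poiseuille base flow `U₀(y) = −(1/2µ)(dp/dx)(h² − y²) i = (G/2ν)(h² − y²) e_x` with
`G = −(1/ρ) dp/dx > 0` the driving pressure gradient per unit mass. [cite: Dou2026c, §2.1 PDF p.5 l.8–11] -/
def poiseuille (ν G h : ℝ) (x : EuclideanSpace ℝ (Fin 3)) : EuclideanSpace ℝ (Fin 3) :=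
  (G / (2 * ν) * (h ^ 2 - (x 1) ^ 2)) • e 0

/-- The driving pressure (per unit mass) `p(x) = −G x`. [cite: Dou2026c, §2.1 PDF p.5 («pressure-driven»)] -/
def drivingPressure (G : ℝ) (_t : ℝ) (x : EuclideanSpace ℝ (Fin 3)) : ℝ := -G * x 0

/-- The Reynolds number (4): `Re = U_{x0c} h/ν` with the centreline velocity `U_{x0c} = G h²/(2ν)`.
[cite: Dou2026c, eq. (4) PDF p.5] -/
def reynoldsP (ν G h : ℝ) : ℝ := G * h ^ 2 / (2 * ν) * h / ν

/-- **A solution of the printed channel problem on the time set `S` (rendered class)**: `u, p`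
jointly smooth on `S × ℝ³`; the unforced momentum equation (3) and `∇·u = 0` hold IN THE OPEN SLAB;
no-slip `u = 0` on the walls; PRESSURE-DRIVEN with the gradient `G` of the base flow (pressure =
`−Gx` + a remainder bounded on the slab) and BOUNDED velocity on the slab at each time (Appendix
§8.1 «pressure-driven plane Poiseuille laminar flow … bounded and smooth disturbances»; rev 2,
referee lane ref-2 g2 RETYPE §1 (ii)/R#3: without these two clauses the typed Theorem 3.1 had a
kernel-cheap witness OUTSIDE the printed class — an unbounded harmonic shear with zero pressure).
RENDERING of `C([0,∞); H³_{σ,0}(Ω))` by smooth fields (module docstring, Δ5).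
[cite: Dou2026c, eq. (3) and §2.1 PDF p.4–5; Appendix §8.1 PDF p.18] -/
structure IsChannelSolutionOn (S : Set ℝ) (ν G h : ℝ)
    (u : ℝ → EuclideanSpace ℝ (Fin 3) → EuclideanSpace ℝ (Fin 3))
    (p : ℝ → EuclideanSpace ℝ (Fin 3) → ℝ) : Prop where
  smooth_velocity : IsSmoothSpaceTimeOn S u
  smooth_pressure : IsSmoothSpaceTimeOn S p
  momentum : ∀ t ∈ S, ∀ x ∈ slab h,
    timeDerivWithin S u t x + convect (u t) (u t) x = ν • (Δ (u t)) x - gradient (p t) x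
  divFree : ∀ t ∈ S, ∀ x ∈ slab h, VectorCalculus.divergence (u t) x = 0
  noSlip : ∀ t ∈ S, ∀ x ∈ walls h, u t x = 0
  /-- «pressure-driven» (§2.1 p.5, Appendix §8.1): the pressure is the driving linear part `−Gx`
  plus a remainder bounded on the slab at each time. -/
  pressure_driven : ∀ t ∈ S, ∃ M : ℝ, ∀ x ∈ slab h, |p t x + G * x 0| ≤ M
  /-- «bounded and smooth disturbances» (Appendix §8.1): the velocity is bounded on the slab at
  each time. -/
  velocity_bounded : ∀ t ∈ S, ∃ M : ℝ, ∀ x ∈ slab h, ‖u t x‖ ≤ M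

/-- **Admissible disturbance `v₀`** (§2.1 PDF p.5): smooth, divergence free in the slab, zero on
the walls (so that `u₀ = U₀ + v₀ ∈ H³_{σ,0}`), and «small»: pointwise smaller than the base flow in
the open slab — the grain at which smallness is USED ((22): `|u| ≥ |U| − |v| > 0`; §2.1 «u > 0 in
Ω × [0,T)»). NB: admits `v₀ = 0` (see the module docstring's vacuity/F2 note).
[cite: Dou2026c, §2.1 PDF p.5 l.8–17; Step 2 (2) eq. (22) PDF p.12] -/
structure IsAdmissibleDisturbance (ν G h : ℝ) (v₀ : EuclideanSpace ℝ (Fin 3) → EuclideanSpace ℝ (Fin 3)) :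
    Prop where
  smooth : ContDiff ℝ ∞ v₀
  divFree : ∀ x ∈ slab h, VectorCalculus.divergence v₀ x = 0
  wall : ∀ x ∈ walls h, v₀ x = 0
  small : ∀ x ∈ slab h, ‖v₀ x‖ < ‖poiseuille ν G h x‖

/-! ## The claimed statement (Theorem 4.1, PDF p.10) -/

/-- **THEOREM 4.1 as printed (rendered class), operative conclusion «hence the 3D Navier-Stokes
equations has no global smooth solutions» for plane Poiseuille flow**, the critical Reynolds number
as the parameter `Recr`: for all `ν, G, h > 0`, every admissible disturbance, `Re > Recr` ⇒ no
global solution of the channel problem with `u(·,0) = U₀ + v₀` in the slab.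
[cite: Dou2026c, Theorem 4.1 PDF p.10 l.37–51; abstract PDF p.2] -/
def ClaimedTheorem (Recr : ℝ) : Prop :=
  ∀ (ν G h : ℝ) (v₀ : EuclideanSpace ℝ (Fin 3) → EuclideanSpace ℝ (Fin 3)),
    0 < ν → 0 < G → 0 < h → IsAdmissibleDisturbance ν G h v₀ → Recr < reynoldsP ν G h →
      ¬ ∃ (u : ℝ → EuclideanSpace ℝ (Fin 3) → EuclideanSpace ℝ (Fin 3))
          (p : ℝ → EuclideanSpace ℝ (Fin 3) → ℝ),
          IsChannelSolutionOn (Ici 0) ν G h u p ∧ ∀ x ∈ slab h, u 0 x = poiseuille ν G h x + v₀ x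

/-- Existential reading of «when Re > Re_cr». [cite: Dou2026c, Theorem 4.1 PDF p.10; §2.2 PDF p.5–6] -/
def ClaimedTheoremE : Prop := ∃ Recr : ℝ, ClaimedTheorem Recr

/-- **Definition 3.1 (Navier–Stokes singularity), PDF p.9**, rendered: local H¹-vanishing of `Δu`
at `x*` as `t ↗ t*` AND `u(·,t*)` not identically zero on the ball (for continuous `u` the printed
«limsup ‖u(·,t)‖_{H³(B_ε(x*))} > 0»). Recorded; the composition runs through the contradiction
(21)/(22) directly. [cite: Dou2026c, Definition 3.1 PDF p.9 l.47–52] -/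
def IsSingularDef31 (u : ℝ → EuclideanSpace ℝ (Fin 3) → EuclideanSpace ℝ (Fin 3)) (tstar : ℝ)
    (xstar : EuclideanSpace ℝ (Fin 3)) (ε : ℝ) : Prop :=
  Tendsto (fun t => h1LocalSq (Δ (u t)) xstar ε) (𝓝[<] tstar) (𝓝 0) ∧
    ¬ ∀ x ∈ Metric.ball xstar ε, u tstar x = 0

/-! ## The steps -/

/-- **Step 0 — §2.1 PDF p.5 l.8–11**: «the initial laminar velocity field is a steady plane
Poiseuille flow … U₀(y) = −(1/2µ)(dp/dx)(h² − y²) i»: the Poiseuille profile with the driving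
pressure `−Gx` is a steady solution of the typed channel problem on every time set. True
(polynomial calculus; proof offered summit-side). [cite: Dou2026c, §2.1 PDF p.5 l.8–11] -/
def Step0_baseFlow : Prop :=
  ∀ (S : Set ℝ) (ν G h : ℝ), 0 < ν →
    IsChannelSolutionOn S ν G h (fun _ => poiseuille ν G h) (drivingPressure G)

/-- **Step 1 — Step 1 items (2)–(3) with (20), PDF p.12 l.14–56, and the «∂u/∂t = 0 at the extreme
of the disturbance» clause §3.2 item 2(b) PDF p.9**: «For Re > Re_cr, the disturbance velocity
v(t) is amplified by the nonlinear term (u·∇)u … Since ΔU(t) ∈ H¹(Ω) (bounded), there exists t*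
and x* such that Δv(x*,t*) = −ΔU(x*,t*) as |Δv(x*,t*)| grows with time, hence Δu(x*,t*) = 0. By
H¹-continuity, lim_{t→t*} ‖Δu(·,t)‖_{H¹(B_ε(x*))} = 0. (20)»: every global solution with
`Re > Re_cr` has an interior point `x*`, a time `t* > 0` and `ε > 0` (ball inside the slab) with
`∂_t u(x*,t*) = 0` and the local H¹-vanishing (20). Typist's flag: asserted (unfilled gap); for
`v₀ = 0` false by Step 0 (`ΔU₀ ≡ −(G/ν) e_x ≠ 0`). [cite: Dou2026c, §4.2 Step 1 (2)–(3), eq. (20) PDF p.12; §3.2 item 2(b) PDF p.9] -/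
def Step1_vanishingPoint (Recr : ℝ) : Prop :=
  ∀ (ν G h : ℝ) (v₀ : EuclideanSpace ℝ (Fin 3) → EuclideanSpace ℝ (Fin 3))
    (u : ℝ → EuclideanSpace ℝ (Fin 3) → EuclideanSpace ℝ (Fin 3)) (p : ℝ → EuclideanSpace ℝ (Fin 3) → ℝ),
    0 < ν → 0 < G → 0 < h → IsAdmissibleDisturbance ν G h v₀ → Recr < reynoldsP ν G h →
    IsChannelSolutionOn (Ici 0) ν G h u p → (∀ x ∈ slab h, u 0 x = poiseuille ν G h x + v₀ x) →
      ∃ tstar : ℝ, 0 < tstar ∧ ∃ xstar ∈ slab h, ∃ ε : ℝ, 0 < ε ∧ Metric.ball xstar ε ⊆ slab h ∧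
        timeDerivWithin (Ici 0) u tstar xstar = 0 ∧
        Tendsto (fun t => h1LocalSq (Δ (u t)) xstar ε) (𝓝[<] tstar) (𝓝 0)

/-- **Step 2 — THEOREM 3.1 (16) PDF p.9 = (A3) PDF p.19, AT THE PRINTED CLASS**: «For laminar
pressure-driven flow and wall no-slip boundary conditions, at a position in the given flow domain,
if the temporal term and the Laplace of the velocity vector are both zero, the velocity is zero,
i.e., If ∂u/∂t = 0 and ‖∆u(x,t)‖ = 0, then |u(x,t)| = 0. (16)»; Appendix Lemma 2 PDF p.19
l.53–68 carries it («there is no potential barrier to drive the velocity field … the velocity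
field cannot form a non-zero flow at this point, so |u(x,t)| = 0»). Typed for channel solutions on
`[0,∞)` (pressure-driven, bounded — Appendix §8.1) at interior points. Typist's flag: unfilled gap
(axiom-level sentence); general form =
`Dou2026b.Step6_EVMP` with `f = 0`, kernel-false by plane Couette, which §7 item 7 scopes out.
[cite: Dou2026c, Theorem 3.1 eq. (16) PDF p.9 l.10–16; Appendix (A3), Lemma 2 PDF p.19] -/
def Step2_thm31 : Prop :=
  ∀ (ν G h : ℝ) (u : ℝ → EuclideanSpace ℝ (Fin 3) → EuclideanSpace ℝ (Fin 3))
    (p : ℝ → EuclideanSpace ℝ (Fin 3) → ℝ), 0 < ν → 0 < G → 0 < h → IsChannelSolutionOn (Ici 0) ν G h u p →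
    ∀ t : ℝ, 0 < t → ∀ x ∈ slab h, timeDerivWithin (Ici 0) u t x = 0 → (Δ (u t)) x = 0 → u t x = 0

/-- **The consequent of Step 2 (1): (21) at the printed class** — local H¹-vanishing of `Δu` at
`x*` as `t ↗ t*` with `∂_t u(x*,t*) = 0` forces `u(·,t*) = 0` on `B_ε(x*)` («lim ‖u(·,t)‖_{H³(B_ε
(x*))} = 0», rendered for continuous `u`). General form = `Dou2026b.LocalVanishing` (kernel-false by
Couette, outside the printed class). [cite: Dou2026c, §4.2 Step 2 (1) eq. (21) PDF p.12 l.72–78] -/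
def LocalVanishingChannel : Prop :=
  ∀ (ν G h : ℝ) (u : ℝ → EuclideanSpace ℝ (Fin 3) → EuclideanSpace ℝ (Fin 3))
    (p : ℝ → EuclideanSpace ℝ (Fin 3) → ℝ), 0 < ν → 0 < G → 0 < h → IsChannelSolutionOn (Ici 0) ν G h u p →
    ∀ tstar : ℝ, 0 < tstar → ∀ xstar ∈ slab h, ∀ ε : ℝ, 0 < ε → Metric.ball xstar ε ⊆ slab h →
      timeDerivWithin (Ici 0) u tstar xstar = 0 →
      Tendsto (fun t => h1LocalSq (Δ (u t)) xstar ε) (𝓝[<] tstar) (𝓝 0) →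
        ∀ x ∈ Metric.ball xstar ε, u tstar x = 0

/-- **Step 3 — Step 2 (1) PDF p.12 l.72–78, THE DECISIVE STEP per the typist's PREDICTION**: «By
Eq.(16), which is the analytical result from EVMP, lim_{t→t*} ‖Δu(·,t)‖_{H¹(B_ε(x*))} = 0 implies
lim_{t→t*} ‖u(·,t)‖_{H³(B_ε(x*))} = 0. (21)» — the printed inference `(16) ⇒ (21)`. Typist's flag:
unfilled gap / LOGIC (a pointwise statement under `Δu(x*,t*) = 0` is applied to conclude vanishing
on a ball; no intermediate display). [cite: Dou2026c, §4.2 Step 2 (1) PDF p.12 l.72–78] -/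
def Step3_16to21 : Prop :=
  Step2_thm31 → LocalVanishingChannel

/-- **Step 4 — Step 2 (2) (22) PDF p.12 l.79–88 with §2.1 «u > 0 in Ω × [0,T)» PDF p.5**: «for t <
t*, U ∈ H³(Ω) implies U(x*,t) > 0 (pressure-driven flow), and ‖v(t)‖_{H³(B_ε(x*))} ≪ ‖U(t)‖_{H³
(B_ε(x*))} (laminar flow constraint). By Sobolev embedding … ‖u(t)‖_{L∞(B_ε(x*))} ≥ ‖U(t)‖ −
‖v(t)‖ > 0. (22)», used at `t = t*` in (3): every global solution issued from admissible data is
non-zero at every interior point and time. Typist's flag: asserted (unfilled gap).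
[cite: Dou2026c, §4.2 Step 2 (2)–(3) eq. (22) PDF p.12 l.79–103; §2.1 PDF p.5] -/
def Step4_positivity : Prop :=
  ∀ (ν G h : ℝ) (v₀ : EuclideanSpace ℝ (Fin 3) → EuclideanSpace ℝ (Fin 3))
    (u : ℝ → EuclideanSpace ℝ (Fin 3) → EuclideanSpace ℝ (Fin 3)) (p : ℝ → EuclideanSpace ℝ (Fin 3) → ℝ),
    0 < ν → 0 < G → 0 < h → IsAdmissibleDisturbance ν G h v₀ →
    IsChannelSolutionOn (Ici 0) ν G h u p → (∀ x ∈ slab h, u 0 x = poiseuille ν G h x + v₀ x) →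
      ∀ t : ℝ, 0 ≤ t → ∀ x ∈ slab h, u t x ≠ 0

/-! ## Kernel composition (Step 2 (1)–(3) ⇒ Theorem 4.1) -/

/-- **KERNEL COMPOSITION — Step 1 → Step 2 → Step 3 → Step 4 → ClaimedTheorem**: a global solution
has the `(x*, t*, ε)` of Step 1; (16) ⇒ (21) makes `u(·,t*)` vanish on `B_ε(x*)`, while (22) makes
`u(x*,t*) ≠ 0` — the contradiction of Step 2 (3); hence no global smooth solution (Theorem 4.1's
last clause). Pure logic; nothing asserted. [cite: Dou2026c, §4.2 Step 2 (1)–(3) PDF p.12; Theorem 4.1 PDF p.10] -/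
theorem claim_of_steps (Recr : ℝ) (h1 : Step1_vanishingPoint Recr) (h2 : Step2_thm31)
    (h3 : Step3_16to21) (h4 : Step4_positivity) : ClaimedTheorem Recr := by
  intro ν G h v₀ hν hG hh hv hRe hex
  obtain ⟨u, p, hsol, hinit⟩ := hex
  obtain ⟨ts, hts, xs, hxs, ε, hε, hball, hdt, hlim⟩ :=
    h1 ν G h v₀ u p hν hG hh hv hRe hsol hinit
  have hzero : u ts xs = 0 :=
    h3 h2 ν G h u p hν hG hh hsol ts hts xs hxs ε hε hball hdt hlim xs (Metric.mem_ball_self hε)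
  exact h4 ν G h v₀ u p hν hG hh hv hsol hinit ts hts.le xs hxs hzero

/-- The existential reading follows from any instance. [cite: Dou2026c, Theorem 4.1 PDF p.10] -/
theorem claimedE_of_claimed {Recr : ℝ} (h : ClaimedTheorem Recr) : ClaimedTheoremE := ⟨Recr, h⟩

/-! ## Step 0 discharged: the steady Poiseuille flow is a solution of the typed channel problem (§2.1 PDF p.5) -/

section Step0

open Literature.Analysis.FluidPDE.PolyFieldCert Literature.Analysis.Calculus.MvPoly
open scoped InnerProductSpace

/-- The Poiseuille components as polynomials: `(c (h² − X₁²), 0, 0)`, `c = G/(2ν)` (non-Prop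
plumbing for the polynomial-field bridge). [folklore] -/
private def poisPoly (ν G h : ℝ) : Fin 3 → MvPolynomial (Fin 3) ℝ :=
  ![MvPolynomial.C (G / (2 * ν)) * (MvPolynomial.C (h ^ 2) - MvPolynomial.X 1 ^ 2), 0, 0]

/-- The driving pressure as a polynomial: `−G X₀` (non-Prop plumbing). [folklore] -/
private def pressPoly (G : ℝ) : MvPolynomial (Fin 3) ℝ := MvPolynomial.C (-G) * MvPolynomial.X 0

/-- A derivation kills numerals. [folklore] -/
private theorem pderiv_ofNat (i : Fin 3) (n : ℕ) [n.AtLeastTwo] :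
    MvPolynomial.pderiv i (OfNat.ofNat n : MvPolynomial (Fin 3) ℝ) = 0 := by
  have h : (OfNat.ofNat n : MvPolynomial (Fin 3) ℝ) = ((OfNat.ofNat n : ℕ) : MvPolynomial (Fin 3) ℝ) :=
    (Nat.cast_ofNat).symm
  rw [h]
  exact Derivation.map_natCast _ _

/-- `poiseuille = polyField poisPoly`. [folklore] -/
private theorem poiseuille_eq_polyField (ν G h : ℝ) :
    poiseuille ν G h = polyField (poisPoly ν G h) := by
  funext x
  ext i
  fin_cases i <;> simp [poiseuille, e, poisPoly, polyField_apply, toFun_apply]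

/-- `drivingPressure G t = toFun pressPoly`. [folklore] -/
private theorem drivingPressure_eq_toFun (G t : ℝ) : drivingPressure G t = toFun (pressPoly G) := by
  funext x
  simp [drivingPressure, pressPoly, toFun_apply]

/-- `(u·∇)u = 0` for the Poiseuille field (it depends on `y` only and points along `x`). [folklore] -/
private theorem convect_poiseuille (ν G h : ℝ) (x : EuclideanSpace ℝ (Fin 3)) :
    convect (poiseuille ν G h) (poiseuille ν G h) x = 0 := by
  rw [poiseuille_eq_polyField]
  ext i
  rw [convect_polyField_apply, Fin.sum_univ_three]
  fin_cases i
  · simp [polyField_apply, poisPoly]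
  · simp [poisPoly]
  · simp [poisPoly]

/-- `Δ u = −(G/ν) e_x` for the Poiseuille field. [folklore] -/
private theorem laplacian_poiseuille (ν G h : ℝ) (hν : ν ≠ 0) (x : EuclideanSpace ℝ (Fin 3)) :
    (Δ (poiseuille ν G h)) x = (-(G / ν)) • e 0 := by
  rw [poiseuille_eq_polyField]
  ext i
  rw [laplacian_polyField_apply, Fin.sum_univ_three]
  fin_cases i
  · have h2 : MvPolynomial.pderiv 1 (2 : MvPolynomial (Fin 3) ℝ) = 0 := pderiv_ofNat 1 2
    simp [e, poisPoly, Derivation.leibniz, toFun_apply, h2]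
    field_simp
  · simp [poisPoly, e]
  · simp [poisPoly, e]

/-- `∇p = −G e_x` for the driving pressure. [folklore] -/
private theorem gradient_drivingPressure (G t : ℝ) (x : EuclideanSpace ℝ (Fin 3)) :
    gradient (drivingPressure G t) x = (-G) • e 0 := by
  rw [drivingPressure_eq_toFun]
  ext i
  rw [gradient_toFun_apply]
  fin_cases i <;> simp [pressPoly, e, Derivation.leibniz, toFun_apply]

/-- `div u = 0` for the Poiseuille field. [folklore] -/
private theorem divergence_poiseuille (ν G h : ℝ) (x : EuclideanSpace ℝ (Fin 3)) :
    VectorCalculus.divergence (poiseuille ν G h) x = 0 := by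
  rw [poiseuille_eq_polyField, divergence_polyField, Fin.sum_univ_three]
  simp [poisPoly]

/-- The Poiseuille field is smooth. [folklore] -/
private theorem contDiff_poiseuille (ν G h : ℝ) : ContDiff ℝ ∞ (poiseuille ν G h) := by
  rw [poiseuille_eq_polyField]; exact contDiff_polyField _

/-- **Step 0 HOLDS (kernel): the steady Poiseuille flow `U₀(y) = (G/2ν)(h² − y²) e_x` with the
driving pressure `−Gx` is a solution of the typed channel problem on every time set** (§2.1 PDF p.5
l.8–11: «the initial laminar velocity field is a steady plane Poiseuille flow …»): smooth,
`∂ₜU₀ = 0`, `(U₀·∇)U₀ = 0`, `νΔU₀ = −G e_x = ∇p`, divergence free, zero on the walls `y = ±h`,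
pressure-driven with remainder `0`, bounded by `|G/2ν| h²` on the slab — polynomial calculus via the
tree's `PolynomialFieldCertificates` bridge. The same statement is independently kernel-certified
Summits-side (`Summit.NavierStokesRegularity.NavierStokesRegularity.Theorems.Dou2026c.poiseuille_isChannelSolution`
in `SoloRefuteDou2026c.lean`, typist-3 g2's kit adopted by the refuter of record, whose proof this
discharge follows verbatim); it is re-proved here, where the fact is declared, because Literature
cannot import Summits. An in-file discharge of the setting's exact solution (the step recorded for
the vacuity audit; not consumed by `claim_of_steps`); no statement of the file is modified.
[cite: Dou2026c, §2.1 PDF p.5 l.8–11] -/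
theorem step0_holds : Step0_baseFlow := by
  intro S ν G h hν
  refine ⟨?_, ?_, ?_, ?_, ?_, ?_, ?_⟩
  · exact ((contDiff_poiseuille ν G h).comp contDiff_snd).contDiffOn
  · have : ContDiff ℝ ∞ (Function.uncurry (drivingPressure G)) := by
      have h0 : ContDiff ℝ ∞ (fun z : ℝ × EuclideanSpace ℝ (Fin 3) => z.2 0) :=
        (EuclideanSpace.proj (0 : Fin 3) : EuclideanSpace ℝ (Fin 3) →L[ℝ] ℝ).contDiff.comp contDiff_snd
      exact contDiff_const.mul h0
    exact this.contDiffOn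
  · intro t _ x _
    have hνG : ν * -(G / ν) = -G := by field_simp
    rw [timeDerivWithin, derivWithin_fun_const, convect_poiseuille, laplacian_poiseuille ν G h hν.ne',
      gradient_drivingPressure, smul_smul, hνG]
    simp
  · intro t _ x _
    exact divergence_poiseuille ν G h x
  · intro t _ x hx
    rcases hx with hx | hx <;> simp [poiseuille, hx]
  · intro t _
    exact ⟨0, fun x _ => by simp [drivingPressure]⟩
  · intro t _
    refine ⟨|G / (2 * ν)| * h ^ 2, fun x hx => ?_⟩
    have he : ‖(e 0 : EuclideanSpace ℝ (Fin 3))‖ = 1 := by simp [e]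
    have h1 : 0 < h ^ 2 - (x 1) ^ 2 := by nlinarith [hx.1, hx.2]
    rw [poiseuille, norm_smul, he, mul_one, Real.norm_eq_abs, abs_mul, abs_of_pos h1]
    exact mul_le_mul_of_nonneg_left (by nlinarith [sq_nonneg (x 1)]) (abs_nonneg _)

end Step0

end Literature.Claims.NS.Dou2026c

end

-- WHAT THIS IS NOT: not a claim about NS regularity or blow-up; not a claim about any author beyond the typed locator.

/-! ## `_holds` aliases (appended 2026-08-28, flt-inv gen 65)

The named fact(s) below are already theorems of THIS file under another name; the alias records the
discharge under the tree's exact naming convention `X_holds` (D-0026 bookkeeping: the proof term is the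
existing theorem; no statement, definition or attribute is edited; no new named fact).  The ledger's debt
table listed each as unproved (`ledger fact claim` GRANTED «status unproved», 2026-08-28T08:5xZ). -/

/-- `Step0_baseFlow` — Step 0 (§2.1: the base flow is a steady solution) holds (`Literature.Claims.NS.Dou2026c.step0_holds`). [cite: Dou2026c, §2.1 PDF p.5 l.8–11] -/
theorem _root_.Literature.Claims.NS.Dou2026c.Step0_baseFlow_holds : _root_.Literature.Claims.NS.Dou2026c.Step0_baseFlow :=
  _root_.Literature.Claims.NS.Dou2026c.step0_holds
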